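import Literature.AlgebraicGeometry.Resolution.DenseLiftedFrobeniusClosedBasis
import Literature.AlgebraicGeometry.Resolution.DiscreteCoefficientSubfield
import Literature.AlgebraicGeometry.Resolution.HenselizedFunctionFieldsImmediate
import Literature.AlgebraicGeometry.Resolution.ResidueTranscendentalExtensions
import Literature.AlgebraicGeometry.Resolution.RankOneDensity
import Literature.AlgebraicGeometry.Resolution.HenselRootsAmbient
import Mathlib.FieldTheory.PrimitiveElement
import HarnessLib

/-!
# The lifted Frobenius-closed basis in mixed characteristic (Kuhlmann 2010, §4.2, Lemma 4.11)

Topic: `Literature/AlgebraicGeometry/Resolution` (valued function fields). F.-V. Kuhlmann,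
*Elimination of ramification I: The generalized stability theorem*, Trans. AMS 362 (2010)
5697–5727 = arXiv:1003.5678, §4.2, **Lemma 4.11** (p. 15 of the arXiv version), the mixed
characteristic case of Lemma 4.7 — the input of Prop. 4.13 (`KummerDegreePResidue.lean`, towards
the named fact `Kuhlmann2010Prop413ResidueDegree`):

> Note that `K₀(x)‾ = K̄(x̄)`. So we may choose a polynomial `g(X,Y) ∈ K₀[X,Y]` with coefficients
> of value `≥ 0` such that `g` has the same degree in `Y` as `f`, and `ḡ(X,Y) = f̄(X,Y)` … it
> follows by Hensel's Lemma that `g(x,Y)` has exactly one zero `y' ∈ F` with `ȳ' = ȳ`. …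
> `K(x)^h(y') = K(x)^h(y) = F`. Hence … `[K₀(x,y):K₀(x)] = [K̄₀(x̄,ȳ):K̄₀(x̄)]` … the function
> field `F₀ := K₀(x,y)` … `F̄₀ = K̄₀(x̄,ȳ) = F̄` and `F = K(x)^h(y) = K(x,y)^h = (K.F₀)^h`. Now we
> lift the Frobenius-closed basis `𝓑̄` of `F̄|K̄` to `F₀`. … `𝓑 = {1} ∪ {u^{pⁿ} | n ∈ ℕ and
> u ∈ 𝓑'}` is a valuation independent set … `R₀ = K₀[𝓑]` … Since `vR₀ = v_pℚ = vF₀` and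
> `R̄₀ = F̄ = F̄₀` and since the value group `v_pℚ` is isomorphic to `ℤ`, we conclude that `R₀` is
> dense in `F₀`. … Since `R₀` is dense in `F₀` and `K` is of rank 1 by assumption, `R` is dense in
> the ring `R' := K[F₀]` … `F` is the henselization of the quotient field of `R'`. Since the rank
> of `F` is 1, the field Quot(`R'`) is dense in its henselization by Lemma 2.4 … Hence `R`
> satisfies (LFC1). By construction, `𝓑` is a valuation basis of `R` over `K`, containing `1`,
> closed under `p`-th powers and such that `𝓑̄` is a Frobenius-closed basis of `F̄|K̄`.

## Content (everything PROVED)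

* `resid_eval_eq_aeval`, `resid_coeff_derivative`, `exists_monic_lift` — coefficientwise lifts of
  polynomials over a residue field `Lv` to `L ∩ V` ("`ḡ = f̄`"), residues of their values and of
  their derivatives.
* `exists_discrete_function_subfield` — **the function field `F₀ = K₀(x)(y)`**: for `F` in the
  class `IsHenselizedInertiallyGeneratedRT V K` and `K₀ ≤ K` with `K₀v = Kv`, `vK₀ ⊆ v(p)^ℤ`
  (`DiscreteCoefficientSubfield.lean`): `x, y ∈ F₀ ≤ F` with `vF₀ ⊆ v(p)^ℤ` (fundamental
  inequality, `e = 1`), `Fv ≤ F₀v` (primitive element `ȳ` of the separable `Fv|K(x)^hv`, Hensel's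
  Lemma `exists_root_of_isHenselianField`), and `F ≤ K(x,y)^h` (degree count and
  `henselization_mono`).
* `exists_famSum_valuation_sub_lt`, `exists_famSum_valuation_sub_le_pow` — "`R₀` is dense in `F₀`"
  (discreteness); `exists_famSum_valuation_sub_lt_of_mem_span` — "`R` is dense in `R' = K[F₀]`";
  `exists_mem_span_F₀_valuation_inv_sub_lt` — inverses in the closure of `K[F₀]` (the argument of
  Lemma 4.9); `exists_famSum_valuation_sub_lt_of_mem` — density in `F` (Lemma 2.4 =
  `exists_mem_valuation_sub_lt_of_isRankOneValued`, `RankOneDensity.lean`).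
* `exists_isDenseLiftedFrobeniusClosedBasis` — **Lemma 4.11**: given in addition a `Kv`-basis of
  `Fv` of the graded form `{1} ∪ {s̄ⱼ^{pⁿ}}` ("`𝓑̄ = {1} ∪ {ū^{pⁿ} | …}`"), the powers of lifts
  `uⱼ ∈ F₀ ∩ V` of the `s̄ⱼ` form an `IsDenseLiftedFrobeniusClosedBasis V p K F B`
  (`DenseLiftedFrobeniusClosedBasis.lean`); the finite heights follow from the injectivity of the
  graded family.

## Sources

* F.-V. Kuhlmann, *Elimination of ramification I: The generalized stability theorem*, Trans.
  Amer. Math. Soc. 362 (2010) 5697–5727 = arXiv:1003.5678: §1 (1), §2.1 (Lemmas 2.2, 2.4, 2.5),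
  §4.2 (Lemma 4.9, Lemma 4.11 and its proof, pp. 14–15). [Kuhlmann2010]

## Rendering notes

* Ambient rendering (`(Ω, V)` algebraically closed, `char Ω = 0`, `char Ωv = p`; the class
  `IsHenselizedInertiallyGeneratedRT`, `HenselizedFunctionFields.lean`). "`vF₀ = ℤvp`" is `every
  non-zero element of F₀ has value v(p)ⁿ, n ∈ ℤ`; linear combinations of the lifted family `fam`
  are `f.sum (fun i c => c * fam i)` for `f : ι →₀ K`.
* The Frobenius-closed basis of `Fv|Kv` enters as a HYPOTHESIS in graded form (a family
  `Unit ⊕ (J × ℕ) → Ωv`, `() ↦ 1`, `(j, n) ↦ s̄ⱼ^{pⁿ}`, linearly independent over `Kv` and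
  spanning `Fv`), which is the shape produced by `FrobeniusClosedBasisOfFiltration.lean`
  (`fcVec`); its existence for the function field `Fv|Kv` ([K5] Thm. 10) is not proved here.
* The polynomial `g(X,Y)` of the source is replaced by the one-variable lift over `K₀(x) ∩ V` of
  the minimal polynomial of a primitive element `ȳ`; `K` algebraically closed is not used in this
  file (only `K₀v = Kv`, `vK₀ ⊆ v(p)^ℤ`, and the class).
-/

noncomputable section

open IsLocalRing

namespace Literature.AlgebraicGeometry.Resolution

universe u

variable {Ω : Type u} [Field Ω] (V : ValuationSubring Ω)

/-! ### Lifting a polynomial over a residue field coefficientwise -/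

section LiftPoly

variable {V}

/-- **Residues of values of a coefficientwise lift**: if `g ∈ Ω[X]` has coefficients in `V`
reducing to those of `q ∈ k[X]` (`k ≤ Ωv`), then `g(a)‾ = q(ā)` for `a ∈ V`. [folklore] -/
theorem resid_eval_eq_aeval {k : Subfield (ResidueField V)} {g : Polynomial Ω} {q : Polynomial k}
    (hgV : ∀ i, g.coeff i ∈ V) (hgq : ∀ i, resid V (g.coeff i) = ((q.coeff i : k) : ResidueField V))
    {a : Ω} (ha : a ∈ V) : resid V (g.eval a) = Polynomial.aeval (resid V a) q := by
  set N := g.natDegree + q.natDegree + 1 with hN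
  rw [Polynomial.eval_eq_sum_range' (show g.natDegree < N by omega),
    Polynomial.aeval_eq_sum_range' (show q.natDegree < N by omega),
    resid_sum V _ _ fun i _ => mul_mem (hgV i) (pow_mem ha i)]
  refine Finset.sum_congr rfl fun i _ => ?_
  rw [resid_mul V (hgV i) (pow_mem ha i), resid_pow V ha, hgq, Algebra.smul_def]
  rfl

/-- The derivative of a coefficientwise lift is a coefficientwise lift of the derivative.
[folklore] -/
theorem resid_coeff_derivative {k : Subfield (ResidueField V)} {g : Polynomial Ω} {q : Polynomial k}
    (hgV : ∀ i, g.coeff i ∈ V) (hgq : ∀ i, resid V (g.coeff i) = ((q.coeff i : k) : ResidueField V)) (i : ℕ) :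
    (Polynomial.derivative g).coeff i ∈ V ∧
      resid V ((Polynomial.derivative g).coeff i) = (((Polynomial.derivative q).coeff i : k) : ResidueField V) := by
  rw [Polynomial.coeff_derivative, Polynomial.coeff_derivative]
  refine ⟨mul_mem (hgV _) (add_mem (natCast_mem V i) V.one_mem), ?_⟩
  rw [resid_mul V (hgV _) (add_mem (natCast_mem V i) V.one_mem), hgq,
    resid_add V (natCast_mem V i) V.one_mem, resid_one]
  have hnat : resid V (i : Ω) = i := by
    rw [resid_of_mem V (natCast_mem V i)]
    exact map_natCast (residue V) i
  rw [hnat]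
  push_cast
  ring

/-- **A monic lift of a monic polynomial over a residue field.** For a subfield `L ≤ Ω` and a
monic `q` over `Lv = residueSubfield L V`, there is a monic `g ∈ Ω[X]` of the same degree with
coefficients in `L ∩ V` reducing to those of `q`. [folklore] -/
theorem exists_monic_lift (L : Subfield Ω) {q : Polynomial (residueSubfield L V)} (hq : q.Monic) :
    ∃ g : Polynomial Ω, g.Monic ∧ g.natDegree = q.natDegree ∧ (∀ i, g.coeff i ∈ V ∧ g.coeff i ∈ L) ∧
      ∀ i, resid V (g.coeff i) = ((q.coeff i : residueSubfield L V) : ResidueField V) := by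
  classical
  set d := q.natDegree with hd
  have hcoef : ∀ i, ∃ c ∈ L, c ∈ V ∧ resid V c = ((q.coeff i : residueSubfield L V) : ResidueField V) :=
    fun i => exists_resid_eq_of_mem_residueSubfield V (q.coeff i).2
  choose c hcL hcV hc using hcoef
  set g : Polynomial Ω := Polynomial.X ^ d + ∑ i ∈ Finset.range d, Polynomial.C (c i) * Polynomial.X ^ i
    with hg
  have hdeg : (∑ i ∈ Finset.range d, Polynomial.C (c i) * Polynomial.X ^ i).degree < (d : WithBot ℕ) := by
    refine (Polynomial.degree_sum_le _ _).trans_lt ?_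
    refine (Finset.sup_lt_iff (WithBot.bot_lt_coe d)).mpr fun i hi => ?_
    rw [Finset.mem_range] at hi
    exact (Polynomial.degree_C_mul_X_pow_le i _).trans_lt (WithBot.coe_lt_coe.mpr hi)
  have hmonic : g.Monic := Polynomial.monic_X_pow_add hdeg
  have hnat : g.natDegree = d := by
    rw [hg, Polynomial.natDegree_add_eq_left_of_degree_lt, Polynomial.natDegree_X_pow]
    rwa [Polynomial.degree_X_pow]
  have hcoeff : ∀ i, g.coeff i = if i = d then 1 else if i < d then c i else 0 := by
    intro i
    rw [hg, Polynomial.coeff_add, Polynomial.coeff_X_pow, Polynomial.finsetSum_coeff]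
    simp_rw [Polynomial.coeff_C_mul_X_pow]
    rw [Finset.sum_ite_eq (Finset.range d) i c]
    simp only [Finset.mem_range]
    by_cases hi : i = d
    · subst hi
      simp
    · rw [if_neg hi, if_neg hi, zero_add]
  refine ⟨g, hmonic, hnat, fun i => ?_, fun i => ?_⟩
  · rw [hcoeff]
    split_ifs
    · exact ⟨V.one_mem, L.one_mem⟩
    · exact ⟨hcV i, hcL i⟩
    · exact ⟨V.zero_mem, L.zero_mem⟩
  · rw [hcoeff]
    by_cases hi : i = d
    · rw [if_pos hi, resid_one, hi]
      have : (q.coeff d : residueSubfield L V) = 1 := hq.coeff_natDegree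
      rw [this]
      rfl
    · rw [if_neg hi]
      by_cases hi' : i < d
      · rw [if_pos hi', hc]
      · rw [if_neg hi', resid_zero]
        have : q.coeff i = 0 := Polynomial.coeff_eq_zero_of_natDegree_lt (by omega)
        rw [this]
        rfl

end LiftPoly

/-! ### Transport along equal subfields -/

section Transport

variable {V}

/-- Separability over equal subfields. [folklore] -/
theorem isSeparable_of_subfield_eq {Φ : Type*} [Field Φ] {A B : Subfield Φ} (h : A = B) {x : Φ}
    (hx : IsSeparable A x) : IsSeparable B x := by
  subst h
  exact hx

/-- A residue-transcendental element over `K` is residue-transcendental over any `K₀ ≤ K` with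
the same residue field. [folklore] -/
theorem IsResidueTranscendental.of_residueSubfield_eq {K K₀ : Subfield Ω} {x : Ω}
    (hx : IsResidueTranscendental V K x) (hres : residueSubfield K₀ V = residueSubfield K V) :
    IsResidueTranscendental V K₀ x := by
  refine ⟨hx.mem, fun halg => hx.2 ?_⟩
  have h1 : resField V K₀ = resField V K := by
    rw [← residueSubfield_subfield_eq_resField, ← residueSubfield_subfield_eq_resField, hres]
  exact isAlgebraic_of_subfield_eq h1 halg

/-- `relfinrank` is monotone in the larger field, for subfields of finite relative degree. [folklore] -/
theorem relfinrank_le_of_le_of_pos {Φ : Type*} [Field Φ] {A B C : Subfield Φ} (hAB : A ≤ B) (hBC : B ≤ C)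
    (hpos : 0 < Subfield.relfinrank A C) : Subfield.relfinrank A B ≤ Subfield.relfinrank A C := by
  rw [Subfield.relfinrank_eq_finrank_of_le hAB, Subfield.relfinrank_eq_finrank_of_le (hAB.trans hBC)] at *
  haveI : FiniteDimensional A (Subfield.extendScalars (hAB.trans hBC)) := Module.finite_of_finrank_pos hpos
  exact IntermediateField.finrank_le_of_le_right ((Subfield.extendScalars_le_extendScalars_iff _ _).mpr hBC)

end Transport

/-! ### Lemma 4.11: the discretely valued function field `F₀ = K₀(x, y')` -/

section F0

variable {V} [IsAlgClosed Ω] {p : ℕ} {K F K₀ : Subfield Ω}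

/-- **Kuhlmann 2010, Lemma 4.11 (the function field `F₀`)**: "Note that `K₀(x)‾ = K̄(x̄)`. So we
may choose a polynomial `g(X,Y) ∈ K₀[X,Y]` with coefficients of value `≥ 0` such that `g` has
the same degree in `Y` as `f`, and `ḡ(X,Y) = f̄(X,Y)` … From (4.14) it follows by Hensel's Lemma
that `g(x,Y)` has exactly one zero `y' ∈ F` with `ȳ' = ȳ`. … `y ∈ K(x)^h(y')` and we have shown
that `K(x)^h(y') = K(x)^h(y) = F`. Hence … `[K₀(x,y):K₀(x)] = [K̄₀(x̄,ȳ):K̄₀(x̄)] = [K(x,y):K(x)]`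
… `F̄₀ = K̄₀(x̄,ȳ) = F̄` and `F = K(x)^h(y) = K(x,y)^h`." Rendering: for `F` in the class
`IsHenselizedInertiallyGeneratedRT V K` over an algebraically closed `K` and a subfield `K₀ ≤ K`
with `K₀v = Kv` and `vK₀ ⊆ v(p)^ℤ`, there are `x, y ∈ F` and a subfield `K₀ ≤ F₀ ≤ F` containing
them with `vF₀ ⊆ v(p)^ℤ`, `Fv ≤ F₀v`, and `F ≤ K(x,y)^h`. PROVED along the printed lines: `ȳ` a
primitive element of the finite separable `Fv | K(x)^hv = K₀(x)v` (unramified; Lemma 2.5 and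
Lemma 2.2), the minimal polynomial of `ȳ` lifted to `K₀(x) ∩ V` and Hensel's Lemma in the henselian
`F` give `y`; `F₀ = K₀(x)(y)` has `e = 1` by the fundamental inequality (so `vF₀ = vK₀(x) = vK₀`)
and residue field `K₀(x)v(ȳ) = Fv`; `K(x)^h(y) = F` by degree count, and `K(x)^h(y) ≤ K(x,y)^h`.
[cite: Kuhlmann2010, Lemma 4.11 (proof)] -/
theorem exists_discrete_function_subfield (hF : IsHenselizedInertiallyGeneratedRT V K F)
    (hK₀K : K₀ ≤ K) (hres : residueSubfield K V ≤ residueSubfield K₀ V)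
    (hdisc : ∀ a ∈ K₀, a ≠ 0 → ∃ n : ℤ, V.valuation a = V.valuation (p : Ω) ^ n) :
    ∃ (x y : Ω) (F₀ : Subfield Ω), K₀ ≤ F₀ ∧ F₀ ≤ F ∧ x ∈ F₀ ∧ y ∈ F₀ ∧
      (∀ a ∈ F₀, a ≠ 0 → ∃ n : ℤ, V.valuation a = V.valuation (p : Ω) ^ n) ∧
      residueSubfield F V ≤ residueSubfield F₀ V ∧
      F ≤ henselization V (IntermediateField.adjoin K ({x, y} : Set Ω)).toSubfield := by
  classical
  have hFhens := hF.isHenselianField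
  obtain ⟨x, hx, hr, hunr⟩ := hF
  set Kx := (IntermediateField.adjoin K ({x} : Set Ω)).toSubfield with hKx
  set Kxh := henselization V Kx with hKxh
  obtain ⟨hKxhF, hpos, hdegres, hsep, -⟩ := hunr
  have hresK₀ : residueSubfield K₀ V = residueSubfield K V :=
    le_antisymm (residueSubfield_subfield_mono hK₀K) hres
  have hx₀ : IsResidueTranscendental V K₀ x := hx.of_residueSubfield_eq hresK₀
  ------------------------------------------------------------------ `L = K₀(x)`
  set L := (IntermediateField.adjoin K₀ ({x} : Set Ω)).toSubfield with hL
  have hK₀L : K₀ ≤ L := subfield_le_toSubfield _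
  have hxL : x ∈ L := IntermediateField.subset_adjoin K₀ ({x} : Set Ω) rfl
  have hxKx : x ∈ Kx := IntermediateField.subset_adjoin K ({x} : Set Ω) rfl
  have hLKx : L ≤ Kx := by
    have : IntermediateField.adjoin K₀ ({x} : Set Ω) ≤ Subfield.extendScalars (hK₀K.trans (subfield_le_toSubfield _)) :=
      IntermediateField.adjoin_simple_le_iff.mpr ((Subfield.mem_extendScalars
        (h := hK₀K.trans (subfield_le_toSubfield _))).mpr hxKx)
    exact fun z hz => this hz
  have hLF : L ≤ F := hLKx.trans ((le_henselization V Kx).trans hKxhF)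
  have hvalL : valueSubgroup L V = valueSubgroup K₀ V := valueSubgroup_adjoin_eq_of_isResidueTranscendental V hx₀
  have hdiscL := forall_valuation_eq_zpow_of_valueSubgroup_le hdisc hvalL.le
  ------------------------------------------------------------------ residue fields: `K(x)^hv = Lv`
  have hk₂ : residueSubfield Kxh V = residueSubfield L V := by
    rw [(IsImmediateOver.valueSubgroup_eq_and_residueSubfield_eq V (le_henselization V Kx)
        (Kuhlmann2010HenselizationImmediate_holds Ω V Kx)).2,
      residueSubfield_adjoin_eq_of_isResidueTranscendental V hx, hL,
      residueSubfield_adjoin_eq_of_isResidueTranscendental V hx₀, hresK₀]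
  set k₂ := residueSubfield L V with hk₂def
  set Fbar := residueSubfield F V with hFbar
  have hk₂F : k₂ ≤ Fbar := residueSubfield_subfield_mono hLF
  have hn : Subfield.relfinrank Kxh F = Subfield.relfinrank k₂ Fbar := by rw [hdegres, hk₂]
  have hfinpos : 0 < Subfield.relfinrank k₂ Fbar := hn ▸ hpos
  have hsep' : ∀ r ∈ Fbar, IsSeparable k₂ r := fun r hr => isSeparable_of_subfield_eq hk₂ (hsep r hr)
  ------------------------------------------------------------------ a primitive element `ȳ`
  set Fext := Subfield.extendScalars hk₂F with hFext
  haveI : FiniteDimensional k₂ Fext := by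
    refine Module.finite_of_finrank_pos ?_
    rw [← Subfield.relfinrank_eq_finrank_of_le hk₂F]
    exact hfinpos
  haveI : Algebra.IsSeparable k₂ Fext :=
    ⟨fun z => IsSeparable.of_algHom (f := Fext.val) (hsep' (z : ResidueField V) z.2)⟩
  obtain ⟨α, hα⟩ := Field.exists_primitive_element k₂ Fext
  set ybar : ResidueField V := (α : ResidueField V) with hybar
  have hybarF : ybar ∈ Fbar := α.2
  have hprim : ∀ r ∈ Fbar, r ∈ IntermediateField.adjoin k₂ ({ybar} : Set (ResidueField V)) := by
    intro r hr
    have h1 : (⟨r, hr⟩ : Fext) ∈ (⊤ : IntermediateField k₂ Fext) := trivial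
    rw [← hα] at h1
    have h2 : Fext.val ⟨r, hr⟩ ∈ (IntermediateField.adjoin k₂ ({α} : Set Fext)).map Fext.val := by
      rw [← SetLike.mem_coe, IntermediateField.coe_map]
      exact ⟨_, h1, rfl⟩
    rw [IntermediateField.adjoin_map, Set.image_singleton] at h2
    exact h2
  have hint : IsIntegral k₂ ybar := (isAlgebraic_of_relfinrank_pos hk₂F hfinpos hybarF).isIntegral
  set q := minpoly k₂ ybar with hq
  have hqmonic : q.Monic := minpoly.monic hint
  have hqsep : q.Separable := hsep' ybar hybarF
  ------------------------------------------------------------------ Hensel's Lemma in `F`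
  obtain ⟨g, hgmonic, hgdeg, hgcoef, hgq⟩ := exists_monic_lift L hqmonic
  obtain ⟨y₀, hy₀F, hy₀V, hy₀⟩ := exists_resid_eq_of_mem_residueSubfield V hybarF
  have hgV : ∀ i, g.coeff i ∈ V := fun i => (hgcoef i).1
  have happrox : V.valuation (g.eval y₀) < 1 := by
    rw [← resid_eq_zero_iff V (eval_mem_valuationSubring_of_coeff_mem V hgV hy₀V),
      resid_eval_eq_aeval hgV hgq hy₀V, hy₀, hq, minpoly.aeval]
  have hder : V.valuation ((Polynomial.derivative g).eval y₀) = 1 := by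
    have hdV : ∀ i, (Polynomial.derivative g).coeff i ∈ V := fun i => (resid_coeff_derivative hgV hgq i).1
    rw [← resid_ne_zero_iff V (eval_mem_valuationSubring_of_coeff_mem V hdV hy₀V),
      resid_eval_eq_aeval hdV (fun i => (resid_coeff_derivative hgV hgq i).2) hy₀V, hy₀]
    exact hqsep.aeval_derivative_ne_zero (minpoly.aeval k₂ ybar)
  obtain ⟨y, hyF, hyV, hgy, hyy₀⟩ := exists_root_of_isHenselianField V hFhens hgmonic
    (fun i => ⟨hgV i, hLF (hgcoef i).2⟩) hy₀F hy₀V happrox hder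
  have hyres : resid V y = ybar := by
    rw [← hy₀, resid_eq_resid_iff V hyV hy₀V]
    exact hyy₀
  ------------------------------------------------------------------ `F₀ = L(y)`
  set F₀ := (IntermediateField.adjoin L ({y} : Set Ω)).toSubfield with hF₀
  have hLF₀ : L ≤ F₀ := subfield_le_toSubfield _
  have hyF₀ : y ∈ F₀ := IntermediateField.subset_adjoin L ({y} : Set Ω) rfl
  have hF₀F : F₀ ≤ F := by
    have : IntermediateField.adjoin L ({y} : Set Ω) ≤ Subfield.extendScalars hLF :=
      IntermediateField.adjoin_simple_le_iff.mpr ((Subfield.mem_extendScalars (h := hLF)).mpr hyF)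
    exact fun z hz => this hz
  -- the degree `[F₀ : L] ≤ deg q`
  have hlifts : g ∈ Polynomial.lifts (algebraMap L Ω) := by
    rw [Polynomial.lifts_iff_coeff_lifts]
    intro i
    exact ⟨⟨g.coeff i, (hgcoef i).2⟩, rfl⟩
  obtain ⟨gL, hgLmap, hgLdeg, hgLmonic⟩ := Polynomial.lifts_and_degree_eq_and_monic hlifts hgmonic
  have hyroot : Polynomial.aeval y gL = 0 := by
    rw [Polynomial.aeval_def, ← Polynomial.eval_map, hgLmap]
    exact hgy
  have hyint : IsIntegral L y := ⟨gL, hgLmonic, by rwa [Polynomial.aeval_def] at hyroot⟩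
  have hext : Subfield.extendScalars hLF₀ = IntermediateField.adjoin L ({y} : Set Ω) :=
    IntermediateField.toSubfield_injective (Subfield.extendScalars_toSubfield hLF₀)
  have hdegF₀ : Subfield.relfinrank L F₀ = (minpoly L y).natDegree := by
    rw [Subfield.relfinrank_eq_finrank_of_le hLF₀, hext, IntermediateField.adjoin.finrank hyint]
  have hposF₀ : 0 < Subfield.relfinrank L F₀ := by
    rw [hdegF₀]; exact minpoly.natDegree_pos hyint
  have hdegle : Subfield.relfinrank L F₀ ≤ q.natDegree := by
    rw [hdegF₀, ← hgdeg]
    have h1 := minpoly.degree_le_of_ne_zero L y hgLmonic.ne_zero hyroot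
    rw [Polynomial.degree_eq_natDegree (minpoly.ne_zero hyint), hgLdeg,
      Polynomial.degree_eq_natDegree hgmonic.ne_zero, Nat.cast_le] at h1
    exact h1
  -- the residue field of `F₀` contains `ȳ`, hence `Fv`
  have hybarF₀ : ybar ∈ residueSubfield F₀ V := hyres ▸ resid_mem_residueSubfield V hyF₀
  have hFbarF₀ : Fbar ≤ residueSubfield F₀ V := by
    intro r hr
    have hk₂F₀ : k₂ ≤ residueSubfield F₀ V := residueSubfield_subfield_mono hLF₀
    have : IntermediateField.adjoin k₂ ({ybar} : Set (ResidueField V)) ≤ Subfield.extendScalars hk₂F₀ :=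
      IntermediateField.adjoin_simple_le_iff.mpr ((Subfield.mem_extendScalars (h := hk₂F₀)).mpr hybarF₀)
    exact this (hprim r hr)
  -- `e(F₀|L) = 1`, so `vF₀ ⊆ v(p)^ℤ`
  obtain ⟨he, hf, hef⟩ := relIndex_mul_relfinrank_le_relfinrank V hLF₀ hposF₀
  have hnf := natDegree_minpoly_le_relfinrank_residue hLF₀ hf hybarF₀ hint.isAlgebraic
  have he1 : (valueSubgroup L V).relIndex (valueSubgroup F₀ V) = 1 := by
    refine le_antisymm (Nat.le_of_mul_le_mul_right ?_ hf) he
    rw [one_mul]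
    exact hef.trans (hdegle.trans hnf)
  have hdiscF₀ := forall_valuation_eq_zpow_of_valueSubgroup_le hdiscL (Subgroup.relIndex_eq_one.mp he1)
  ------------------------------------------------------------------ `F = K(x)^h(y) ≤ K(x,y)^h`
  set M := (IntermediateField.adjoin Kxh ({y} : Set Ω)).toSubfield with hM
  have hKxhM : Kxh ≤ M := subfield_le_toSubfield _
  have hyM : y ∈ M := IntermediateField.subset_adjoin Kxh ({y} : Set Ω) rfl
  have hMF : M ≤ F := by
    have : IntermediateField.adjoin Kxh ({y} : Set Ω) ≤ Subfield.extendScalars hKxhF :=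
      IntermediateField.adjoin_simple_le_iff.mpr ((Subfield.mem_extendScalars (h := hKxhF)).mpr hyF)
    exact fun z hz => this hz
  -- `[M : K(x)^h] ≥ [Mv : K(x)^hv] ≥ [Fv : K(x)^hv] = [F : K(x)^h]`
  have hyintM : IsIntegral Kxh y := by
    refine ⟨gL.map (Subfield.inclusion (hLKx.trans (le_henselization V Kx))), hgLmonic.map _, ?_⟩
    rw [Polynomial.eval₂_map]
    have : (algebraMap Kxh Ω).comp (Subfield.inclusion (hLKx.trans (le_henselization V Kx))) = algebraMap L Ω := rfl
    rw [this, ← Polynomial.aeval_def]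
    exact hyroot
  have hextM : Subfield.extendScalars hKxhM = IntermediateField.adjoin Kxh ({y} : Set Ω) :=
    IntermediateField.toSubfield_injective (Subfield.extendScalars_toSubfield hKxhM)
  have hposM : 0 < Subfield.relfinrank Kxh M := by
    rw [Subfield.relfinrank_eq_finrank_of_le hKxhM, hextM, IntermediateField.adjoin.finrank hyintM]
    exact minpoly.natDegree_pos hyintM
  obtain ⟨heM, hfM, hefM⟩ := relIndex_mul_relfinrank_le_relfinrank V hKxhM hposM
  have hybarM : ybar ∈ residueSubfield M V := hyres ▸ resid_mem_residueSubfield V hyM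
  have hFbarM : Fbar ≤ residueSubfield M V := by
    intro r hr
    have hk₂M : k₂ ≤ residueSubfield M V := by
      have := residueSubfield_subfield_mono (V := V) hKxhM
      rwa [hk₂] at this
    have : IntermediateField.adjoin k₂ ({ybar} : Set (ResidueField V)) ≤ Subfield.extendScalars hk₂M :=
      IntermediateField.adjoin_simple_le_iff.mpr ((Subfield.mem_extendScalars (h := hk₂M)).mpr hybarM)
    exact this (hprim r hr)
  have hfM' : Subfield.relfinrank k₂ Fbar ≤ Subfield.relfinrank (residueSubfield Kxh V) (residueSubfield M V) := by
    rw [hk₂]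
    rw [hk₂] at hfM
    exact relfinrank_le_of_le_of_pos hk₂F hFbarM hfM
  have hdegM : Subfield.relfinrank Kxh F ≤ Subfield.relfinrank Kxh M := by
    rw [hn]
    calc Subfield.relfinrank k₂ Fbar ≤ Subfield.relfinrank (residueSubfield Kxh V) (residueSubfield M V) := hfM'
      _ = 1 * _ := (one_mul _).symm
      _ ≤ (valueSubgroup Kxh V).relIndex (valueSubgroup M V) *
            Subfield.relfinrank (residueSubfield Kxh V) (residueSubfield M V) := Nat.mul_le_mul_right _ heM
      _ ≤ Subfield.relfinrank Kxh M := hefM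
  have hMeqF : F ≤ M := by
    have htower := Subfield.relfinrank_mul_relfinrank hKxhM hMF
    have h1 : Subfield.relfinrank M F = 1 := by
      have hne : Subfield.relfinrank M F ≠ 0 := by
        intro h0
        rw [h0, mul_zero] at htower
        exact hpos.ne' htower.symm
      have hle1 : Subfield.relfinrank Kxh M * Subfield.relfinrank M F ≤ Subfield.relfinrank Kxh M * 1 := by
        rw [htower, mul_one]
        exact hdegM
      have := Nat.le_of_mul_le_mul_left hle1 hposM
      omega
    exact Subfield.relfinrank_eq_one_iff.mp h1
  set E := (IntermediateField.adjoin K ({x, y} : Set Ω)).toSubfield with hE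
  have hKxE : Kx ≤ E := by
    have : IntermediateField.adjoin K ({x} : Set Ω) ≤ IntermediateField.adjoin K ({x, y} : Set Ω) :=
      IntermediateField.adjoin.mono K _ _ (Set.singleton_subset_iff.mpr (Set.mem_insert x {y}))
    exact fun z hz => this hz
  have hyE : y ∈ E := IntermediateField.subset_adjoin K ({x, y} : Set Ω) (Set.mem_insert_of_mem x rfl)
  have hME : M ≤ henselization V E := by
    have hKxhE : Kxh ≤ henselization V E :=
      henselization_mono V (Kuhlmann2010HenselizationIsHenselian_holds) hKxE
    have : IntermediateField.adjoin Kxh ({y} : Set Ω) ≤ Subfield.extendScalars hKxhE :=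
      IntermediateField.adjoin_simple_le_iff.mpr ((Subfield.mem_extendScalars (h := hKxhE)).mpr
        (le_henselization V E hyE))
    exact fun z hz => this hz
  exact ⟨x, y, F₀, hK₀L.trans hLF₀, hF₀F, hLF₀ hxL, hyF₀, hdiscF₀, hFbarF₀, hMeqF.trans hME⟩

end F0

/-! ### Density of the `K`-linear combinations of the lifted family -/

section Density

variable {V} {p : ℕ} [hp : Fact p.Prime]
variable {K F K₀ F₀ : Subfield Ω} {ι : Type u} (fam : ι → Ω)

omit hp in
/-- Linear combinations of the family: additivity. [folklore] -/
theorem famSum_add (f g : ι →₀ K) :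
    ((f + g).sum fun i c => (c : Ω) * fam i) = (f.sum fun i c => (c : Ω) * fam i) + g.sum fun i c => (c : Ω) * fam i := by
  refine Finsupp.sum_add_index' (fun i => ?_) (fun i b₁ b₂ => ?_)
  · rw [ZeroMemClass.coe_zero]; exact zero_mul _
  · rw [Subfield.coe_add]; exact add_mul _ _ _

omit hp in
/-- Linear combinations of the family: scaling. [folklore] -/
theorem famSum_smul (a : K) (f : ι →₀ K) :
    ((a • f).sum fun i c => (c : Ω) * fam i) = (a : Ω) * f.sum fun i c => (c : Ω) * fam i := by
  rw [Finsupp.sum_smul_index' (fun i => by rw [ZeroMemClass.coe_zero]; exact zero_mul _),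
    Finsupp.sum, Finsupp.sum, Finset.mul_sum]
  refine Finset.sum_congr rfl fun i _ => ?_
  rw [smul_eq_mul, Subfield.coe_mul, mul_assoc]

omit hp in
/-- A linear combination with coefficients in `K₀` lies in `F₀`. [folklore] -/
theorem famSum_mem_of_coeff (hK₀F₀ : K₀ ≤ F₀) (hfamF₀ : ∀ i, fam i ∈ F₀) (f : ι →₀ K)
    (hf : ∀ i, (f i : Ω) ∈ K₀) : (f.sum fun i c => (c : Ω) * fam i) ∈ F₀ :=
  sum_mem fun i _ => mul_mem (hK₀F₀ (hf i)) (hfamF₀ i)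

omit hp in
/-- A linear combination lies in `F`. [folklore] -/
theorem famSum_mem (hKF : K ≤ F) (hF₀F : F₀ ≤ F) (hfamF₀ : ∀ i, fam i ∈ F₀) (f : ι →₀ K) :
    (f.sum fun i c => (c : Ω) * fam i) ∈ F :=
  sum_mem fun i _ => mul_mem (hKF (f i).2) (hF₀F (hfamF₀ i))

variable (hK₀K : K₀ ≤ K) (hK₀F₀ : K₀ ≤ F₀) (hF₀F : F₀ ≤ F)
  (hres : residueSubfield K V ≤ residueSubfield K₀ V)
  (hfamV : ∀ i, fam i ∈ V)
  (hspan : ∀ r ∈ residueSubfield F V,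
    r ∈ Submodule.span (residueSubfield K V) (Set.range fun i => resid V (fam i)))

include hK₀K hK₀F₀ hF₀F hres hfamV hspan in
/-- **One step of the approximation inside `F₀`** (Kuhlmann 2010, Lemma 4.11: "Since
`vR₀ = v_pℚ = vF₀` and `R̄₀ = F̄ = F̄₀` … we conclude that `R₀` is dense in `F₀`"): for
`0 ≠ a ∈ F₀` there is a linear combination `t` of the family with coefficients in `K₀` with
`v(a - t) < v(a)`, namely `t = c ∑ ẽᵢ uᵢ` where `v(a) = v(c)`, `c = pᵏ`, and `ā/c̄ = ∑ ēᵢ ūᵢ`.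
PROVED. [cite: Kuhlmann2010, Lemma 4.11 (proof)] -/
theorem exists_famSum_valuation_sub_lt [CharZero Ω] {a : Ω} (haF₀ : a ∈ F₀) (ha0 : a ≠ 0)
    (hdiscF₀ : ∀ a ∈ F₀, a ≠ 0 → ∃ n : ℤ, V.valuation a = V.valuation (p : Ω) ^ n) :
    ∃ f : ι →₀ K, (∀ i, (f i : Ω) ∈ K₀) ∧ V.valuation (a - f.sum fun i c => (c : Ω) * fam i) < V.valuation a := by
  classical
  have hp0 : (p : Ω) ≠ 0 := Nat.cast_ne_zero.mpr hp.out.ne_zero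
  obtain ⟨k, hk⟩ := hdiscF₀ a haF₀ ha0
  set c : Ω := (p : Ω) ^ k with hc
  have hc0 : c ≠ 0 := zpow_ne_zero k hp0
  have hcK₀ : c ∈ K₀ := zpow_mem (natCast_mem K₀ p) k
  have hvc : V.valuation c = V.valuation a := by rw [hc, map_zpow₀, hk]
  -- `a / c` is a unit of `F₀ ∩ V`
  have hacF₀ : a / c ∈ F₀ := div_mem haF₀ (hK₀F₀ hcK₀)
  have hvac : V.valuation (a / c) = 1 := by rw [map_div₀, hvc, div_self ((map_ne_zero _).mpr ha0)]
  have hacV : a / c ∈ V := (V.valuation_le_one_iff _).mp hvac.le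
  -- expand its residue in the basis
  obtain ⟨l, hl⟩ := Finsupp.mem_span_range_iff_exists_finsupp.mp
    (hspan _ (residueSubfield_subfield_mono hF₀F (resid_mem_residueSubfield V hacF₀)))
  -- lift the coefficients to `K₀ ∩ V`
  have hlift : ∀ r : residueSubfield K V, ∃ e : Ω, e ∈ K₀ ∧ e ∈ V ∧ resid V e = r ∧ (r = 0 → e = 0) := by
    intro r
    by_cases hr : r = 0
    · exact ⟨0, K₀.zero_mem, V.zero_mem, by rw [hr, resid_zero]; rfl, fun _ => rfl⟩
    · obtain ⟨e, heK₀, heV, he⟩ := exists_resid_eq_of_mem_residueSubfield V (hres r.2)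
      exact ⟨e, heK₀, heV, he, fun h => absurd h hr⟩
  choose e heK₀ heV he he0 using hlift
  set f : ι →₀ K := l.mapRange (fun r => (⟨e r, hK₀K (heK₀ r)⟩ : K)) (Subtype.ext (he0 0 rfl)) with hf
  have hfi : ∀ i, (f i : Ω) = e (l i) := fun i => by rw [hf, Finsupp.mapRange_apply]
  -- the residue of the combination is `ā/c̄`
  set t := f.sum fun i c => (c : Ω) * fam i with ht
  have htV : t ∈ V := sum_mem fun i _ => mul_mem (by rw [hfi]; exact heV _) (hfamV i)
  have hrest : resid V t = resid V (a / c) := by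
    rw [ht, Finsupp.sum, resid_sum V _ _ fun i _ => mul_mem (by rw [hfi]; exact heV _) (hfamV i)]
    rw [← hl, Finsupp.sum]
    have hsupp : f.support = l.support := by
      ext i
      rw [Finsupp.mem_support_iff, Finsupp.mem_support_iff, not_iff_not]
      constructor
      · intro h0
        by_contra hne
        have h1 : resid V (e (l i)) = (l i : ResidueField V) := he (l i)
        have h2 : (f i : Ω) = 0 := by rw [h0]; rfl
        rw [hfi] at h2
        rw [h2, resid_zero] at h1
        exact hne (Subtype.ext h1.symm)
      · intro h0
        apply Subtype.ext
        show (f i : Ω) = 0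
        rw [hfi, h0, he0 0 rfl]
    rw [hsupp]
    refine Finset.sum_congr rfl fun i _ => ?_
    rw [resid_mul V (by rw [hfi]; exact heV _) (hfamV i), hfi, he, Algebra.smul_def]
    rfl
  -- hence `v(a/c - t) < 1` and `v(a - c t) < v(a)`, where `c t` is the combination with coefficients `c f`
  have hlt : V.valuation (a / c - t) < 1 := (resid_eq_resid_iff V hacV htV).mp hrest.symm
  have key : a - c * t = c * (a / c - t) := by field_simp
  have hct : c * t = (((⟨c, hK₀K hcK₀⟩ : K) • f).sum fun i c => (c : Ω) * fam i) := by
    rw [famSum_smul]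
  refine ⟨(⟨c, hK₀K hcK₀⟩ : K) • f, fun i => ?_, ?_⟩
  · rw [Finsupp.smul_apply, smul_eq_mul, Subfield.coe_mul, hfi]
    exact mul_mem hcK₀ (heK₀ _)
  · rw [← hct, key, map_mul, hvc]
    calc V.valuation a * V.valuation (a / c - t) < V.valuation a * 1 :=
          mul_lt_mul_of_pos_left hlt ((Valuation.pos_iff _).mpr ha0)
      _ = V.valuation a := mul_one _

include hK₀K hK₀F₀ hF₀F hres hfamV hspan in
/-- **The linear combinations with coefficients in `K₀` are dense in `F₀`** ("`R₀` is dense in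
`F₀`", by the discreteness of `vF₀`): `v(a - t) ≤ v(a)·v(p)^m` for a suitable combination `t`,
for every `m`. PROVED by iterating `exists_famSum_valuation_sub_lt` (each step gains a factor
`v(p)` as the values of `F₀` are the powers of `v(p)`). [cite: Kuhlmann2010, Lemma 4.11 (proof)] -/
theorem exists_famSum_valuation_sub_le_pow [CharZero Ω] (hvp : V.valuation (p : Ω) < 1)
    (hfamF₀ : ∀ i, fam i ∈ F₀)
    (hdiscF₀ : ∀ a ∈ F₀, a ≠ 0 → ∃ n : ℤ, V.valuation a = V.valuation (p : Ω) ^ n)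
    {a : Ω} (haF₀ : a ∈ F₀) (m : ℕ) :
    ∃ f : ι →₀ K, (∀ i, (f i : Ω) ∈ K₀) ∧
      V.valuation (a - f.sum fun i c => (c : Ω) * fam i) ≤ V.valuation a * V.valuation (p : Ω) ^ m := by
  classical
  have hp0 : (p : Ω) ≠ 0 := Nat.cast_ne_zero.mpr hp.out.ne_zero
  have hvp0 : 0 < V.valuation (p : Ω) := (Valuation.pos_iff _).mpr hp0
  induction m with
  | zero =>
    refine ⟨0, fun i => ?_, ?_⟩
    · rw [Finsupp.coe_zero, Pi.zero_apply, ZeroMemClass.coe_zero]; exact K₀.zero_mem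
    · rw [Finsupp.sum_zero_index, sub_zero, pow_zero, mul_one]
  | succ m ih =>
    obtain ⟨f, hf, hfa⟩ := ih
    set a' := a - f.sum fun i c => (c : Ω) * fam i with ha'
    have ha'F₀ : a' ∈ F₀ := sub_mem haF₀ (famSum_mem_of_coeff fam hK₀F₀ hfamF₀ f hf)
    by_cases ha'0 : a' = 0
    · refine ⟨f, hf, ?_⟩
      rw [← ha', ha'0, map_zero]
      exact zero_le
    obtain ⟨g, hg, hga⟩ := exists_famSum_valuation_sub_lt fam hK₀K hK₀F₀ hF₀F hres hfamV hspan ha'F₀ ha'0 hdiscF₀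
    refine ⟨f + g, fun i => ?_, ?_⟩
    · rw [Finsupp.add_apply, Subfield.coe_add]; exact add_mem (hf i) (hg i)
    · rw [famSum_add, ← sub_sub, ← ha']
      -- discreteness: `v(a' - t) < v(a') = v(p)^k` forces `v(a' - t) ≤ v(p)^(k+1)`
      set b := a' - g.sum fun i c => (c : Ω) * fam i with hb
      by_cases hb0 : b = 0
      · rw [hb0, map_zero]; exact zero_le
      have hbF₀ : b ∈ F₀ := sub_mem ha'F₀ (famSum_mem_of_coeff fam hK₀F₀ hfamF₀ g hg)
      obtain ⟨k, hk⟩ := hdiscF₀ a' ha'F₀ ha'0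
      obtain ⟨k', hk'⟩ := hdiscF₀ b hbF₀ hb0
      have hlt : V.valuation b < V.valuation a' := hga
      rw [hk, hk', zpow_lt_zpow_iff_right_of_lt_one₀ hvp0 hvp] at hlt
      calc V.valuation b = V.valuation (p : Ω) ^ k' := hk'
        _ ≤ V.valuation (p : Ω) ^ (k + 1) := (zpow_le_zpow_iff_right_of_lt_one₀ hvp0 hvp).mpr (by omega)
        _ = V.valuation a' * V.valuation (p : Ω) := by rw [zpow_add_one₀ (ne_of_gt hvp0), hk]
        _ ≤ V.valuation a * V.valuation (p : Ω) ^ m * V.valuation (p : Ω) := mul_le_mul_left hfa _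
        _ = V.valuation a * V.valuation (p : Ω) ^ (m + 1) := by rw [pow_succ, mul_assoc]

include hK₀K hK₀F₀ hF₀F hres hfamV hspan in
/-- **The `K`-span of `F₀` is approximated by linear combinations of the family** (the rank of
`F` being one: "`K` is of rank 1 by assumption, `R` is dense in the ring `R' := K[F₀]`").
PROVED by induction on the span. [cite: Kuhlmann2010, Lemma 4.11 (proof)] -/
theorem exists_famSum_valuation_sub_lt_of_mem_span [CharZero Ω] (hKF : K ≤ F) (hvp : V.valuation (p : Ω) < 1)
    (hrank : IsRankOneValued V F) (hfamF₀ : ∀ i, fam i ∈ F₀)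
    (hdiscF₀ : ∀ a ∈ F₀, a ≠ 0 → ∃ n : ℤ, V.valuation a = V.valuation (p : Ω) ^ n)
    {z : Ω} (hz : z ∈ Submodule.span K (F₀ : Set Ω)) :
    ∀ d ∈ F, d ≠ 0 → ∃ f : ι →₀ K, V.valuation (z - f.sum fun i c => (c : Ω) * fam i) < V.valuation d := by
  classical
  have hp0 : (p : Ω) ≠ 0 := Nat.cast_ne_zero.mpr hp.out.ne_zero
  have hvp0 : 0 < V.valuation (p : Ω) := (Valuation.pos_iff _).mpr hp0
  have hpF : (p : Ω) ∈ F := natCast_mem F p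
  induction hz using Submodule.span_induction with
  | mem z hzF₀ =>
    intro d hdF hd0
    have hvd : 0 < V.valuation d := (Valuation.pos_iff _).mpr hd0
    by_cases hz0 : z = 0
    · refine ⟨0, ?_⟩
      rw [hz0, Finsupp.sum_zero_index, sub_zero, map_zero]; exact hvd
    -- `v(z)·v(p)^n ≤ v(d)` for some `n` (the value group of `F` is archimedean)
    obtain ⟨n, hn⟩ := hrank.2 (p : Ω)⁻¹ (F.inv_mem hpF) (z / d) (div_mem (hF₀F hzF₀) hdF)
      (by rw [map_inv₀]; exact one_lt_inv₀ hvp0 |>.mpr hvp)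
    rw [map_div₀, map_inv₀, inv_pow, div_le_iff₀ hvd] at hn
    have h1 : V.valuation z * V.valuation (p : Ω) ^ n ≤ V.valuation d := by
      have := mul_le_mul_left hn (V.valuation (p : Ω) ^ n)
      rwa [mul_right_comm, inv_mul_cancel₀ (pow_ne_zero _ (ne_of_gt hvp0)), one_mul] at this
    obtain ⟨f, -, hf⟩ := exists_famSum_valuation_sub_le_pow fam hK₀K hK₀F₀ hF₀F hres hfamV hspan hvp hfamF₀
      hdiscF₀ hzF₀ (n + 1)
    refine ⟨f, hf.trans_lt ?_⟩
    calc V.valuation z * V.valuation (p : Ω) ^ (n + 1)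
        = V.valuation z * V.valuation (p : Ω) ^ n * V.valuation (p : Ω) := by rw [pow_succ, mul_assoc]
      _ ≤ V.valuation d * V.valuation (p : Ω) := mul_le_mul_left h1 _
      _ < V.valuation d * 1 := mul_lt_mul_of_pos_left hvp hvd
      _ = V.valuation d := mul_one _
  | zero =>
    intro d hdF hd0
    exact ⟨0, by rw [Finsupp.sum_zero_index, sub_zero, map_zero]; exact (Valuation.pos_iff _).mpr hd0⟩
  | add z₁ z₂ _ _ ih₁ ih₂ =>
    intro d hdF hd0
    obtain ⟨f₁, hf₁⟩ := ih₁ d hdF hd0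
    obtain ⟨f₂, hf₂⟩ := ih₂ d hdF hd0
    refine ⟨f₁ + f₂, ?_⟩
    rw [famSum_add, show z₁ + z₂ - (_ + _) = (z₁ - f₁.sum fun i c => (c : Ω) * fam i) +
      (z₂ - f₂.sum fun i c => (c : Ω) * fam i) by ring]
    exact Valuation.map_add_lt _ hf₁ hf₂
  | smul c z _ ih =>
    intro d hdF hd0
    by_cases hc0 : (c : Ω) = 0
    · refine ⟨0, ?_⟩
      rw [Algebra.smul_def, show algebraMap K Ω c = (c : Ω) from rfl, hc0, zero_mul,
        Finsupp.sum_zero_index, sub_zero, map_zero]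
      exact (Valuation.pos_iff _).mpr hd0
    obtain ⟨f, hf⟩ := ih (d / c) (div_mem hdF (hKF c.2)) (div_ne_zero hd0 hc0)
    refine ⟨c • f, ?_⟩
    rw [famSum_smul, Algebra.smul_def, show algebraMap K Ω c = (c : Ω) from rfl, ← mul_sub, map_mul]
    rw [map_div₀, lt_div_iff₀ ((Valuation.pos_iff _).mpr hc0)] at hf
    rwa [mul_comm]

omit hp in
/-- The `K`-span of `F₀` lies in `F` (`K, F₀ ≤ F`). [folklore] -/
theorem mem_of_mem_span_F₀ (hKF : K ≤ F) (hF₀F : F₀ ≤ F) {z : Ω} (hz : z ∈ Submodule.span K (F₀ : Set Ω)) :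
    z ∈ F := by
  induction hz using Submodule.span_induction with
  | mem z hz => exact hF₀F hz
  | zero => exact F.zero_mem
  | add _ _ _ _ h₁ h₂ => exact add_mem h₁ h₂
  | smul c _ _ h => rw [Algebra.smul_def]; exact mul_mem (hKF c.2) h

omit hp in
/-- The `K`-span of `F₀` is closed under multiplication (it is the ring `K[F₀]`). [folklore] -/
theorem mul_mem_span_F₀ {a b : Ω} (ha : a ∈ Submodule.span K (F₀ : Set Ω))
    (hb : b ∈ Submodule.span K (F₀ : Set Ω)) : a * b ∈ Submodule.span K (F₀ : Set Ω) := by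
  have h1 : a * b ∈ Submodule.span K (F₀ : Set Ω) * Submodule.span K (F₀ : Set Ω) := Submodule.mul_mem_mul ha hb
  rw [Submodule.span_mul_span] at h1
  refine Submodule.span_mono ?_ h1
  exact Set.mul_subset_iff.mpr fun x hx y hy => mul_mem hx hy

omit hp in
/-- Powers stay in the `K`-span of `F₀`. [folklore] -/
theorem pow_mem_span_F₀ {a : Ω} (ha : a ∈ Submodule.span K (F₀ : Set Ω)) (n : ℕ) :
    a ^ n ∈ Submodule.span K (F₀ : Set Ω) := by
  induction n with
  | zero => rw [pow_zero]; exact Submodule.subset_span F₀.one_mem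
  | succ n ih => rw [pow_succ]; exact mul_mem_span_F₀ ih ha

/-- **Inverting in the closure of `K[F₀]`** (Kuhlmann 2010, Lemma 4.9: "`1/r = s/(1 - (1 - rs))`
… It remains to show the existence of `s`. The properties `K ⊂ R` and (LFC2) imply that `vR = vF`
and `R̄ = F̄`. Hence there is some `s₁ ∈ R` such that `vrs₁ = 0` and that the residue of the
element `rs₁ ∈ R` has an inverse in `R̄`, say `s̄₂` … by the geometric expansion …"): for
`0 ≠ Q ∈ K[F₀]`, `Q⁻¹` is approximated by elements of `K[F₀]` to within any value of `F^×`
(`vF = vK`, `Fv = F₀v`, rank one). PROVED. [cite: Kuhlmann2010, Lemma 4.9 (proof)] -/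
theorem exists_mem_span_F₀_valuation_inv_sub_lt (hKF : K ≤ F) (hF₀F : F₀ ≤ F) (hrank : IsRankOneValued V F)
    (hvalF : ∀ a ∈ F, a ≠ 0 → ∃ c ∈ K, c ≠ 0 ∧ V.valuation c = V.valuation a)
    (hresF₀ : residueSubfield F V ≤ residueSubfield F₀ V)
    {Q : Ω} (hQ : Q ∈ Submodule.span K (F₀ : Set Ω)) (hQ0 : Q ≠ 0) {d : Ω} (hdF : d ∈ F) (hd0 : d ≠ 0) :
    ∃ w ∈ Submodule.span K (F₀ : Set Ω), V.valuation (Q⁻¹ - w) < V.valuation d := by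
  classical
  have hQF : Q ∈ F := mem_of_mem_span_F₀ hKF hF₀F hQ
  have hvd : 0 < V.valuation d := (Valuation.pos_iff _).mpr hd0
  -- `σ ∈ K[F₀]` with `v(Qσ - 1) < 1`
  obtain ⟨c, hcK, hc0, hvc⟩ := hvalF Q hQF hQ0
  have hQc : V.valuation (Q / c) = 1 := by rw [map_div₀, hvc, div_self ((map_ne_zero _).mpr hQ0)]
  have hQcV : Q / c ∈ V := (V.valuation_le_one_iff _).mp hQc.le
  have hQcF : Q / c ∈ F := div_mem hQF (hKF hcK)
  have hrne : resid V (Q / c) ≠ 0 := (resid_ne_zero_iff V hQcV).mpr hQc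
  obtain ⟨f₀, hf₀F₀, hf₀V, hf₀⟩ := exists_resid_eq_of_mem_residueSubfield V
    (hresF₀ ((residueSubfield F V).inv_mem (resid_mem_residueSubfield V hQcF)))
  set σ : Ω := c⁻¹ * f₀ with hσ
  have hσA : σ ∈ Submodule.span K (F₀ : Set Ω) := by
    rw [hσ, show c⁻¹ * f₀ = (⟨c⁻¹, K.inv_mem hcK⟩ : K) • f₀ from rfl]
    exact Submodule.smul_mem _ _ (Submodule.subset_span hf₀F₀)
  have hQσ : Q * σ = Q / c * f₀ := by rw [hσ]; ring
  have hQσ1 : V.valuation (Q * σ - 1) < 1 := by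
    rw [← resid_eq_resid_iff V (by rw [hQσ]; exact mul_mem hQcV hf₀V) V.one_mem, resid_one, hQσ,
      resid_mul V hQcV hf₀V, hf₀, mul_inv_cancel₀ hrne]
  set τ : Ω := 1 - Q * σ with hτ
  have hτA : τ ∈ Submodule.span K (F₀ : Set Ω) :=
    Submodule.sub_mem _ (Submodule.subset_span F₀.one_mem) (mul_mem_span_F₀ hQ hσA)
  have hvτ : V.valuation τ < 1 := by rw [hτ, ← Valuation.map_neg, neg_sub]; exact hQσ1
  have h1τ : 1 - τ = Q * σ := by rw [hτ]; ring
  have hQσ0 : Q * σ ≠ 0 := by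
    intro h0
    rw [h0, zero_sub, Valuation.map_neg, map_one] at hQσ1
    exact lt_irrefl _ hQσ1
  have hσ0 : σ ≠ 0 := fun h0 => hQσ0 (by rw [h0, mul_zero])
  have hσF : σ ∈ F := mem_of_mem_span_F₀ hKF hF₀F hσA
  have hτF : τ ∈ F := mem_of_mem_span_F₀ hKF hF₀F hτA
  -- `Q⁻¹ = σ/(1 - τ)`; the geometric partial sums approximate it
  by_cases hτ0 : τ = 0
  · refine ⟨σ, hσA, ?_⟩
    have : Q⁻¹ = σ := by
      rw [hτ, sub_eq_zero] at hτ0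
      exact (eq_inv_of_mul_eq_one_right hτ0.symm).symm
    rw [this, sub_self, map_zero]
    exact hvd
  obtain ⟨n, hn⟩ := hrank.2 τ⁻¹ (F.inv_mem hτF) (σ / d) (div_mem hσF hdF)
    (by rw [map_inv₀]; exact one_lt_inv₀ ((Valuation.pos_iff _).mpr hτ0) |>.mpr hvτ)
  rw [map_div₀, map_inv₀, inv_pow, div_le_iff₀ hvd] at hn
  have h1 : V.valuation σ * V.valuation τ ^ n ≤ V.valuation d := by
    have := mul_le_mul_left hn (V.valuation τ ^ n)
    rwa [mul_right_comm, inv_mul_cancel₀ (pow_ne_zero _ ((map_ne_zero _).mpr hτ0)), one_mul] at this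
  set N := n + 1 with hN
  refine ⟨σ * ∑ i ∈ Finset.range N, τ ^ i, mul_mem_span_F₀ hσA
    (Submodule.sum_mem _ fun i _ => pow_mem_span_F₀ hτA i), ?_⟩
  have h1τ0 : (1 - τ) ≠ 0 := by rw [h1τ]; exact hQσ0
  have key : Q⁻¹ - σ * ∑ i ∈ Finset.range N, τ ^ i = σ * τ ^ N / (1 - τ) := by
    have hgeom := geom_sum_mul_neg τ N
    have hQinv : Q⁻¹ = σ / (1 - τ) := by
      rw [h1τ, eq_div_iff hQσ0, inv_mul_eq_iff_eq_mul₀ hQ0]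
    rw [hQinv, eq_div_iff h1τ0, sub_mul, div_mul_cancel₀ _ h1τ0, mul_assoc, hgeom]
    ring
  have hv1τ : V.valuation (1 - τ) = 1 := by
    rw [h1τ]
    have : Q * σ = 1 + (Q * σ - 1) := by ring
    rw [this]
    exact Valuation.map_one_add_of_lt _ hQσ1
  rw [key, map_div₀, hv1τ, div_one, map_mul, map_pow]
  calc V.valuation σ * V.valuation τ ^ N = V.valuation σ * V.valuation τ ^ n * V.valuation τ := by
        rw [hN, pow_succ, mul_assoc]
    _ ≤ V.valuation d * V.valuation τ := mul_le_mul_left h1 _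
    _ < V.valuation d * 1 := mul_lt_mul_of_pos_left hvτ hvd
    _ = V.valuation d := mul_one _

omit hp in
/-- The ring generated by `K ∪ F₀` lies in the `K`-span of `F₀`. [folklore] -/
theorem mem_span_of_mem_subringClosure {z : Ω} (hz : z ∈ Subring.closure ((K : Set Ω) ∪ F₀)) :
    z ∈ Submodule.span K (F₀ : Set Ω) := by
  induction hz using Subring.closure_induction with
  | mem z hz =>
    rcases hz with hzK | hzF₀
    · have : z = (⟨z, hzK⟩ : K) • (1 : Ω) := by rw [Algebra.smul_def, mul_one]; rfl
      rw [this]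
      exact Submodule.smul_mem _ _ (Submodule.subset_span F₀.one_mem)
    · exact Submodule.subset_span hzF₀
  | zero => exact Submodule.zero_mem _
  | one => exact Submodule.subset_span F₀.one_mem
  | add _ _ _ _ h₁ h₂ => exact Submodule.add_mem _ h₁ h₂
  | neg _ _ h => exact Submodule.neg_mem _ h
  | mul _ _ _ _ h₁ h₂ => exact mul_mem_span_F₀ h₁ h₂

include hK₀K hK₀F₀ hF₀F hres hfamV hspan in
/-- **The linear combinations of the family are dense in `F`** (Kuhlmann 2010, Lemma 4.11: "Since
`R₀` is dense in `F₀` and `K` is of rank 1 by assumption, `R` is dense in the ring `R' := K[F₀]`.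
… `F` is the henselization of the quotient field of `R'`. Since the rank of `F` is 1, the field
Quot(`R'`) is dense in its henselization by Lemma 2.4, and the fact that `R` is dense in `R'`
implies that Quot(`R`) is dense in Quot(`R'`). Hence `R` satisfies (LFC1)"): for `F ≤ K(x,y)^h`
with `x, y ∈ F₀`, every element of `F` is approximated by `K`-linear combinations of the family.
PROVED (`exists_mem_valuation_sub_lt_of_isRankOneValued` = Lemma 2.4, then
`exists_mem_span_F₀_valuation_inv_sub_lt` and `exists_famSum_valuation_sub_lt_of_mem_span`).
[cite: Kuhlmann2010, Lemma 4.11 (proof) and Lemma 2.4] -/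
theorem exists_famSum_valuation_sub_lt_of_mem [IsAlgClosed Ω] [CharZero Ω] (hKF : K ≤ F)
    (hvp : V.valuation (p : Ω) < 1) (hrank : IsRankOneValued V F)
    (hvalF : ∀ a ∈ F, a ≠ 0 → ∃ c ∈ K, c ≠ 0 ∧ V.valuation c = V.valuation a)
    (hresF₀ : residueSubfield F V ≤ residueSubfield F₀ V) (hfamF₀ : ∀ i, fam i ∈ F₀)
    (hdiscF₀ : ∀ a ∈ F₀, a ≠ 0 → ∃ n : ℤ, V.valuation a = V.valuation (p : Ω) ^ n)
    {x y : Ω} (hxF₀ : x ∈ F₀) (hyF₀ : y ∈ F₀)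
    (hFh : F ≤ henselization V (IntermediateField.adjoin K ({x, y} : Set Ω)).toSubfield)
    (hrankE : IsRankOneValued V (IntermediateField.adjoin K ({x, y} : Set Ω)).toSubfield)
    {a : Ω} (haF : a ∈ F) {ε : Ω} (hεF : ε ∈ F) (hε0 : ε ≠ 0) :
    ∃ f : ι →₀ K, V.valuation (a - f.sum fun i c => (c : Ω) * fam i) < V.valuation ε := by
  classical
  obtain ⟨c, hcK, hc0, hvc⟩ := hvalF ε hεF hε0
  set E := (IntermediateField.adjoin K ({x, y} : Set Ω)).toSubfield with hE
  have hKE : K ≤ E := subfield_le_toSubfield _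
  obtain ⟨q, hqE, hq⟩ := exists_mem_valuation_sub_lt_of_isRankOneValued hrankE (hFh haF) (hKE hcK) hc0
  rw [hvc] at hq
  -- `q ∈ K(x,y) ⊆ Quot(K[F₀])`: `q = P/Q` with `P, Q ∈ K[F₀]`
  have hqcl : q ∈ Subfield.closure ((K : Set Ω) ∪ F₀) := by
    have hEcl : E ≤ Subfield.closure ((K : Set Ω) ∪ F₀) := by
      rw [hE, IntermediateField.adjoin_toSubfield, range_algebraMap_subfield]
      refine Subfield.closure_mono (Set.union_subset_union_right _ ?_)
      intro z hz
      rcases hz with rfl | rfl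
      · exact hxF₀
      · exact hyF₀
    exact hEcl hqE
  obtain ⟨P, hP, Q, hQ, hPQ⟩ := Subfield.mem_closure_iff.mp hqcl
  have hPA := mem_span_of_mem_subringClosure hP
  have hQA := mem_span_of_mem_subringClosure hQ
  by_cases hPQ0 : P = 0 ∨ Q = 0
  · -- then `q = 0`
    have hq0 : q = 0 := by
      rw [← hPQ]
      rcases hPQ0 with h0 | h0
      · rw [h0, zero_div]
      · rw [h0, div_zero]
    refine ⟨0, ?_⟩
    rw [Finsupp.sum_zero_index, sub_zero]
    rw [hq0, sub_zero] at hq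
    exact hq
  push Not at hPQ0
  obtain ⟨hP0, hQ0⟩ := hPQ0
  have hPF : P ∈ F := mem_of_mem_span_F₀ hKF hF₀F hPA
  -- approximate `Q⁻¹` within `v(c)/v(P)`, then `P·w` within `v(c)`
  obtain ⟨w, hwA, hw⟩ := exists_mem_span_F₀_valuation_inv_sub_lt hKF hF₀F hrank hvalF hresF₀ hQA hQ0
    (div_mem (hKF hcK) hPF) (div_ne_zero hc0 hP0)
  obtain ⟨f, hf⟩ := exists_famSum_valuation_sub_lt_of_mem_span fam hK₀K hK₀F₀ hF₀F hres hfamV hspan hKF hvp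
    hrank hfamF₀ hdiscF₀ (mul_mem_span_F₀ hPA hwA) c (hKF hcK) hc0
  refine ⟨f, ?_⟩
  rw [hvc] at hf
  have key : a - (f.sum fun i c => (c : Ω) * fam i) =
      (a - q) + P * (Q⁻¹ - w) + (P * w - f.sum fun i c => (c : Ω) * fam i) := by
    rw [← hPQ]; ring
  rw [key]
  refine Valuation.map_add_lt _ (Valuation.map_add_lt _ hq ?_) hf
  rw [map_mul]
  rw [map_div₀, lt_div_iff₀ ((Valuation.pos_iff _).mpr hP0), hvc] at hw
  rwa [mul_comm]

end Density

/-! ### Assembly: the dense lifted Frobenius-closed basis (Lemma 4.11) -/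

section Assembly

variable {V} [IsAlgClosed Ω] [CharZero Ω] {p : ℕ} [hp : Fact p.Prime] [CharP (ResidueField V) p]

omit [IsAlgClosed Ω] [CharZero Ω] hp in
/-- `v(p) < 1` when `char Ωv = p`. [folklore] -/
theorem valuation_p_lt_one' : V.valuation (p : Ω) < 1 := by
  have h0 : residue V (p : V) = 0 := by rw [map_natCast, CharP.cast_eq_zero]
  have hmem : (p : V) ∈ maximalIdeal V := (residue_eq_zero_iff _).mp h0
  have := (V.valuation_lt_one_iff _).mp hmem
  simpa using this

/-- **Kuhlmann 2010, Lemma 4.11 (the lifted Frobenius-closed basis, mixed characteristic), from a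
Frobenius-closed basis of `Fv|Kv` in graded form.** "Now we lift the Frobenius-closed basis `𝓑̄`
of `F̄|K̄` to `F₀`. First we observe that every basis element `ū ≠ 1` in `𝓑̄` … there exists an
integer `ν = ν(ū)` such that `ū ∉ F̄^{p^ν}`. Consequently,
`𝓑̄ = {1} ∪ {ū^{pⁿ} | n ∈ ℕ and ū ∈ 𝓑̄ ∖ F̄^p}`. For every `ū ∈ 𝓑̄ ∖ F̄^p` we choose an element
`u ∈ F₀` with residue `ū`. Let `𝓑'` be the collection of all these elements `u`. Then
`𝓑 = {1} ∪ {u^{pⁿ} | n ∈ ℕ and u ∈ 𝓑'}` is a valuation independent set … The ring `K₀[𝓑]` is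
dense in `F₀`, and the ring `R = K[𝓑]` satisfies properties (LFC1), (LFC2) and (LFC3)."
Rendering: for `F` in the class `IsHenselizedInertiallyGeneratedRT V K` (`(Ω, V)` algebraically
closed of characteristic `0` with `char Ωv = p`), a subfield `K₀ ≤ K` as in
`exists_subfield_discrete_residueSubfield_eq` (`DiscreteCoefficientSubfield.lean`), and a
`Kv`-basis of `Fv` of the graded form `{1} ∪ {s̄ⱼ^{pⁿ}}` (the form in which Frobenius-closed bases
of function fields are constructed, `FrobeniusClosedBasisOfFiltration.lean`), the set
`B = {1} ∪ {uⱼ^{pⁿ}}` of powers of lifts `uⱼ ∈ F₀ ∩ V` of the `s̄ⱼ` is an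
`IsDenseLiftedFrobeniusClosedBasis V p K F B` (`DenseLiftedFrobeniusClosedBasis.lean`). PROVED
(finite heights come from the injectivity of the graded family; density is
`exists_famSum_valuation_sub_lt_of_mem`). [cite: Kuhlmann2010, Lemma 4.11] -/
theorem exists_isDenseLiftedFrobeniusClosedBasis {K F K₀ : Subfield Ω}
    (hF : IsHenselizedInertiallyGeneratedRT V K F)
    (hK₀K : K₀ ≤ K) (hres : residueSubfield K V ≤ residueSubfield K₀ V)
    (hdisc : ∀ a ∈ K₀, a ≠ 0 → ∃ n : ℤ, V.valuation a = V.valuation (p : Ω) ^ n)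
    {J : Type u} (sbar : J → ResidueField V) (hsF : ∀ j, sbar j ∈ residueSubfield F V)
    (hli : LinearIndependent (residueSubfield K V)
      (Sum.elim (fun _ : Unit => (1 : ResidueField V)) (fun jn : J × ℕ => sbar jn.1 ^ p ^ jn.2)))
    (hspan : ∀ r ∈ residueSubfield F V, r ∈ Submodule.span (residueSubfield K V)
      (Set.range (Sum.elim (fun _ : Unit => (1 : ResidueField V)) (fun jn : J × ℕ => sbar jn.1 ^ p ^ jn.2)))) :
    ∃ B : Set Ω, IsDenseLiftedFrobeniusClosedBasis V p K F B := by
  classical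
  have hvp : V.valuation (p : Ω) < 1 := valuation_p_lt_one'
  -- data of the class
  have hKF : K ≤ F := by
    obtain ⟨x', -, -, hunr⟩ := id hF
    exact (subfield_le_toSubfield _).trans ((le_henselization V _).trans hunr.le)
  have hvalF : ∀ a ∈ F, a ≠ 0 → ∃ c ∈ K, c ≠ 0 ∧ V.valuation c = V.valuation a := by
    intro a haF ha0
    have hva : V.valuation a ≠ 0 := (map_ne_zero _).mpr ha0
    have hmem : Units.mk0 _ hva ∈ valueSubgroup F V :=
      (mem_valueSubgroup_iff F V _).mpr ⟨⟨a, haF⟩, fun h => ha0 (congrArg Subtype.val h), rfl⟩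
    rw [hF.valueSubgroup_eq] at hmem
    obtain ⟨c, hc0, hc⟩ := (mem_valueSubgroup_iff K V _).mp hmem
    rw [Units.val_mk0] at hc
    exact ⟨c, c.2, fun h => hc0 (Subtype.ext h), hc.symm⟩
  have hrank : IsRankOneValued V F :=
    hF.isRankOneValued_of_algebraic le_rfl fun a ha => isAlgebraic_algebraMap (⟨a, ha⟩ : F)
  obtain ⟨x, y, F₀, hK₀F₀, hF₀F, hxF₀, hyF₀, hdiscF₀, hresF₀, hFh⟩ :=
    exists_discrete_function_subfield hF hK₀K hres hdisc
  have hrankE : IsRankOneValued V (IntermediateField.adjoin K ({x, y} : Set Ω)).toSubfield := by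
    have hEF : (IntermediateField.adjoin K ({x, y} : Set Ω)).toSubfield ≤ F := by
      have : IntermediateField.adjoin K ({x, y} : Set Ω) ≤ Subfield.extendScalars hKF := by
        rw [IntermediateField.adjoin_le_iff]
        intro z hz
        rcases hz with rfl | rfl
        · exact hF₀F hxF₀
        · exact hF₀F hyF₀
      exact fun z hz => this hz
    obtain ⟨a, haK, ha⟩ := hF.exists_one_lt_valuation
    exact hrank.of_le hEF ⟨a, subfield_le_toSubfield _ haK, ha⟩
  ------------------------------------------------------------------ the lifted family
  have hlift : ∀ j, ∃ u ∈ F₀, u ∈ V ∧ resid V u = sbar j := fun j =>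
    exists_resid_eq_of_mem_residueSubfield V (hresF₀ (hsF j))
  choose u huF₀ huV hu using hlift
  set fam : Unit ⊕ (J × ℕ) → Ω := Sum.elim (fun _ => 1) (fun jn => u jn.1 ^ p ^ jn.2) with hfam
  set bfam : Unit ⊕ (J × ℕ) → ResidueField V :=
    Sum.elim (fun _ : Unit => (1 : ResidueField V)) (fun jn : J × ℕ => sbar jn.1 ^ p ^ jn.2) with hbfam
  have hfamV : ∀ i, fam i ∈ V := by
    rintro (i | ⟨j, n⟩)
    · exact V.one_mem
    · exact pow_mem (huV j) _
  have hfamF₀ : ∀ i, fam i ∈ F₀ := by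
    rintro (i | ⟨j, n⟩)
    · exact F₀.one_mem
    · exact pow_mem (huF₀ j) _
  have hfamres : ∀ i, resid V (fam i) = bfam i := by
    rintro (i | ⟨j, n⟩)
    · exact resid_one V
    · show resid V (u j ^ p ^ n) = sbar j ^ p ^ n
      rw [resid_pow V (huV j), hu]
  have hbinj : Function.Injective bfam := hli.injective
  have hfinj : Function.Injective fam := fun i i' h => hbinj (by rw [← hfamres, ← hfamres, h])
  have hbne : ∀ i, bfam i ≠ 0 := fun i => hli.ne_zero i
  have hspan' : ∀ r ∈ residueSubfield F V,
      r ∈ Submodule.span (residueSubfield K V) (Set.range fun i => resid V (fam i)) := by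
    have : (fun i => resid V (fam i)) = bfam := funext hfamres
    rw [this]
    exact hspan
  set e := Equiv.ofInjective fam hfinj with he
  have hrange : Set.range (fun w : Set.range fam => resid V (w : Ω)) = Set.range bfam := by
    ext z
    constructor
    · rintro ⟨⟨_, i, rfl⟩, rfl⟩
      exact ⟨i, (hfamres i).symm⟩
    · rintro ⟨i, rfl⟩
      exact ⟨⟨fam i, i, rfl⟩, hfamres i⟩
  refine ⟨Set.range fam, ?_⟩
  refine
    { le := hKF
      subset := ?_
      one_mem := ⟨Sum.inl (), rfl⟩
      valuation_eq_one := ?_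
      pow_mem := ?_
      resid_linearIndependent := ?_
      resid_span := ?_
      finite_height := ?_
      dense := ?_ }
  · rintro _ ⟨i, rfl⟩
    exact hF₀F (hfamF₀ i)
  · rintro _ ⟨i, rfl⟩
    exact (resid_ne_zero_iff V (hfamV i)).mp (by rw [hfamres]; exact hbne i)
  · rintro _ ⟨i, rfl⟩
    rcases i with i | ⟨j, n⟩
    · exact ⟨Sum.inl (), by simp [hfam]⟩
    · refine ⟨Sum.inr (j, n + 1), ?_⟩
      simp only [hfam, Sum.elim_inr]
      rw [pow_succ, pow_mul]
  · have hfun : (fun w : Set.range fam => resid V (w : Ω)) = bfam ∘ e.symm := by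
      funext w
      obtain ⟨i, hi⟩ := w.2
      have hw : w = e i := Subtype.ext (by rw [he, Equiv.ofInjective_apply]; exact hi.symm)
      rw [hw, Function.comp_apply, Equiv.symm_apply_apply, he, Equiv.ofInjective_apply]
      exact hfamres i
    rw [hfun]
    exact hli.comp e.symm e.symm.injective
  · intro r hr
    rw [hrange]
    exact hspan r hr
  · rintro _ ⟨i, rfl⟩ hne1
    rcases i with i | ⟨j, n⟩
    · exact absurd rfl hne1
    · refine ⟨n + 1, ?_⟩
      rintro _ ⟨i', rfl⟩ heq
      rcases i' with i' | ⟨j', m⟩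
      · have : fam (Sum.inl ()) = fam (Sum.inr (j, n)) := by
          simp only [hfam, Sum.elim_inl, one_pow] at heq ⊢
          exact heq
        exact Sum.inl_ne_inr (hfinj this)
      · have : fam (Sum.inr (j', m + (n + 1))) = fam (Sum.inr (j, n)) := by
          simp only [hfam, Sum.elim_inr] at heq ⊢
          rw [pow_add, pow_mul]
          exact heq
        have h2 := hfinj this
        simp only [Sum.inr.injEq, Prod.mk.injEq] at h2
        omega
  · intro a haF ε hεF hε0
    obtain ⟨f, hf⟩ := exists_famSum_valuation_sub_lt_of_mem fam hK₀K hK₀F₀ hF₀F hres hfamV hspan' hKF hvp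
      hrank hvalF hresF₀ hfamF₀ hdiscF₀ hxF₀ hyF₀ hFh hrankE haF hεF hε0
    refine ⟨f.equivMapDomain e, ?_⟩
    rw [Finsupp.sum_equivMapDomain]
    simp only [he, Equiv.ofInjective_apply]
    exact hf

end Assembly

end Literature.AlgebraicGeometry.Resolution
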